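import Mathlib
import Summits.CriticalPhenomena.CardyFormulaZ2.Theorems.CardySelfRefinementGradientComparabilityKernelsDictionary
import Summits.CriticalPhenomena.CardyFormulaZ2.Theorems.CardySelfRefinementGradientComparabilityStubLevelCurveIFT
import Summits.CriticalPhenomena.CardyFormulaZ2.Theorems.CardySelfRefinementGradientComparabilityStubLevelGapTransport
import HarnessLib

/-!
# `GradientComparability`, line `Sketch`: the bulk chart from the kernels BET, W, R

Route `CardySelfRefinement`, sub-problem `CriticalPhenomena/CardyFormulaZ2`; crux `GradientComparability`
(stmt-CriticalPhenomena-10269), line `Sketch` (card `Ideas/level-curve-window-transport.md`).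
Vocabulary (`M A P Dρ Dc PathOK`, `Aloc`, …) from `CardySelfRefinementDefs` (definitionally the
route's `let`-chain).  The crux: for `k ∈ {2,3}`, every RSW path `γ : (1,0) → (0,½)` of the
self-refinement model `M_k(ρ,c)` and every nonempty finite quad family `F`, the Russo-gradient size
`G(η,q) = |∂ρP| + |∂cP|` is (i) comparable up to one constant between any two path points at equal
small mesh and (ii) tends to `+∞` uniformly along the path.

These `…Kernels*` files are the KERNEL-CHECKED REDUCTION of the crux to the four OPEN registered
stubs of the line (its research kernels), taken as section hypotheses with the stubs' literal
signatures: BET = `stub_transversalSlopeLipschitz` (`hBET`), W = `stub_Dc_windowStability` (`hW`),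
R = `stub_Drho_le_window` (`hR`), CORNER = `stub_cornerTwoCharts` (`hCorner`); every other input of
the line is PROVED in the tree and imported.

## This file (2/3): level curves and the bulk chart

* `levelCurvesAlongPath` — THE two level curves `cm < cp` of `P_η(ρ,·)` over `[0, 1−δ]` solving the
  level-curve ODE `c' = −∂ρP/∂cP` (implicit function theorem `stub_levelCurve_IFT`, proved), with
  the dictionary at the path points (file 1/3);
* `levelCurveData` — the same plus THE BET (transversal Lipschitz bound of the slope field across
  the band between the curves);
* `bulkComparability` — comparability of `G` on `{s | ρ_s ≤ 1 − δ}` by Grönwall transport of the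
  level gap (`stub_levelGapTransport`, proved).
-/

noncomputable section

namespace Summit.CriticalPhenomena.CardyFormulaZ2.Theorems.CardySelfRefinement

open scoped Topology
open Filter Set MeasureTheory
open Literature.Probability.LatticeModels Literature.Probability.Percolation
open Literature.Probability.Percolation.QuadCrossing
open Summit.CriticalPhenomena.CardyFormulaZ2.Theses.CardySelfRefinement

/- (hypothesis `hBET`, registered stub `stub_transversalSlopeLipschitz`)  **THE BET — transversal slope bound (`TransversalSlopeLipschitz`; open, = the route's rank-2
rate `θ₀ > 2 − α₄`).**  In the bulk `ρ ≤ 1 − δ` and for two fixed levels `0 < vlo < vhi < 1`, the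
slope field `R = ∂ρP/∂cP` of the crossing polynomial `P_η` is Lipschitz in `c` ACROSS THE BAND
`{vlo ≤ P_η(ρ,·) ≤ vhi}` with a MESH-UNIFORM constant `Θ`.  (Each of `∂c log ∂ρP`, `∂c log ∂cP` is of
window size `≍ η⁻²π₄`; the bet is that their difference is `O(1)` — a second-order seed-forgetting
cancellation inside ONE model; MC j005815 at `ρ = 0`: relative spread of `R` across the window
`0.465 → 0.312 → 0.227` at `L = 64 → 256`, `∂c log R` between bounded and `∝ 1/W`, undecided.)
Falsifiable: a measured `∂c log R ∝ 1/W(L)` kills it (and TrivialSectorRate's mechanism at `ρ = 0`). -/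
variable (hBET :
    ∀ k : ℕ, k = 2 ∨ k = 3 → ∀ γ : unitInterval → ℝ × ℝ, PathOK k γ →
      ∀ (m : ℕ) (F : Fin m → Quad (Set.univ : Set ℂ)), 0 < m → ∀ δ : ℝ, 0 < δ → δ ≤ 1 / 2 →
        ∀ vlo vhi : ℝ, 0 < vlo → vlo < vhi → vhi < 1 →
          ∃ Θ η₁ : ℝ, 0 ≤ Θ ∧ 0 < η₁ ∧ ∀ η ∈ Set.Ioo 0 η₁, ∀ ρ ∈ Set.Icc (0 : ℝ) (1 - δ),
            ∀ c ∈ Set.Icc (0 : ℝ) 1, ∀ c' ∈ Set.Icc (0 : ℝ) 1,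
              P k m F η ρ c ∈ Set.Icc vlo vhi → P k m F η ρ c' ∈ Set.Icc vlo vhi →
                |Dρ k m F η (ρ, c) / Dc k m F η (ρ, c) - Dρ k m F η (ρ, c') / Dc k m F η (ρ, c')| ≤
                  Θ * |c - c'|)

/- (hypothesis `hW`, registered stub `stub_Dc_windowStability`)  **(W) KESTEN'S WINDOW STABILITY FOR `M_k` (open research kernel, canonical form).**  In the
bulk `ρ ≤ 1 − δ` and for two fixed levels `0 < vlo < vhi < 1`: across the finite-size critical
window `{c ∈ [0,1] : P_η(ρ,c) ∈ [vlo, vhi]}` the Russo derivative `∂cP = Σ_{non-axial e} P(e pivotal)`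
varies by at most a MESH-UNIFORM factor `Λ₂` (Kesten 1987, Thm 1/§5 for Bernoulli percolation:
four-arm counts are stable inside the near-critical window; for the 1-dependent `M_k(ρ,·)`, a
monotone Bernoulli family in the independent non-axial coins over the FKG block environment, not
in print; nearest tree fact `Literature.Probability.Percolation.Kesten1987_zdKestenRelation`,
bond-`ℤ²`, unproved). -/
variable (hW :
    ∀ k : ℕ, k = 2 ∨ k = 3 → ∀ γ : unitInterval → ℝ × ℝ, PathOK k γ →
      ∀ (m : ℕ) (F : Fin m → Quad (Set.univ : Set ℂ)), 0 < m → ∀ δ : ℝ, 0 < δ → δ ≤ 1 / 2 →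
        ∀ vlo vhi : ℝ, 0 < vlo → vlo < vhi → vhi < 1 →
          ∃ Λ₂ η₂ : ℝ, 0 < Λ₂ ∧ 0 < η₂ ∧ ∀ η ∈ Set.Ioo 0 η₂, ∀ ρ ∈ Set.Icc (0 : ℝ) (1 - δ),
            ∀ c ∈ Set.Icc (0 : ℝ) 1, ∀ c' ∈ Set.Icc (0 : ℝ) 1,
              P k m F η ρ c ∈ Set.Icc vlo vhi → P k m F η ρ c' ∈ Set.Icc vlo vhi →
                Dc k m F η (ρ, c) ≤ Λ₂ * Dc k m F η (ρ, c'))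

/- (hypothesis `hR`, registered stub `stub_Drho_le_window`)  **(R) THE `ρ`-DERIVATIVE IS AT MOST WINDOW SIZE (open research kernel).**  In the bulk and for
level selections `cm < cp` of `P_η(ρ,·)` at two fixed levels: at the path points,
`|∂ρP(γ s)| · (cp − cm)(ρ_s) ≤ Λ₃` mesh-uniformly (`∂ρP = ¼Σ_blocks E[Δ₁Δ₂ 1_A]` (k = 2) is a
signed sum of block second differences, each bounded by block-pivotality; block-pivotal counts are
four-arm counts `≍` window⁻¹ by Kesten's relation — for `M_k` not in print). -/
variable (hR :
    ∀ k : ℕ, k = 2 ∨ k = 3 → ∀ γ : unitInterval → ℝ × ℝ, PathOK k γ →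
      ∀ (m : ℕ) (F : Fin m → Quad (Set.univ : Set ℂ)), 0 < m → ∀ δ : ℝ, 0 < δ → δ ≤ 1 / 2 →
        ∀ vlo vhi : ℝ, 0 < vlo → vlo < vhi → vhi < 1 →
          ∃ Λ₃ η₃ : ℝ, 0 < Λ₃ ∧ 0 < η₃ ∧ ∀ η ∈ Set.Ioo 0 η₃, ∀ cm cp : ℝ → ℝ,
            (∀ ρ ∈ Set.Icc (0 : ℝ) (1 - δ), cm ρ ∈ Set.Icc (0 : ℝ) 1 ∧ cp ρ ∈ Set.Icc (0 : ℝ) 1 ∧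
                P k m F η ρ (cm ρ) = vlo ∧ P k m F η ρ (cp ρ) = vhi) →
            ∀ s : unitInterval, (γ s).1 ≤ 1 - δ →
              |Dρ k m F η (γ s)| * (cp (γ s).1 - cm (γ s).1) ≤ Λ₃)

include hW hR in
/-- **Level curves along the path (proved composition):** the Kesten-window input ⨉ the implicit
function theorem ⨉ the polynomial structure of `P` (`exists_contDiff_eq_P`,
`derivWithin_eq_fderiv_fst/snd`) give, in the bulk and for every small mesh, THE two level curves
`cm < cp` of `P_η(ρ,·)` at the levels `vlo < vhi`, inside `[0,1]`, solving the level-curve ODE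
`c' = −∂ρP/∂cP` within `[0, 1−δ]`, together with Kesten's dictionary at the path points. -/
theorem levelCurvesAlongPath :
    ∀ k : ℕ, k = 2 ∨ k = 3 → ∀ γ : unitInterval → ℝ × ℝ, PathOK k γ →
      ∀ (m : ℕ) (F : Fin m → Quad (Set.univ : Set ℂ)), 0 < m → ∀ δ : ℝ, 0 < δ → δ ≤ 1 / 2 →
        ∀ vlo vhi : ℝ, 0 < vlo → vlo < vhi → vhi < 1 →
          ∃ Λ₁ η₁ : ℝ, 0 < Λ₁ ∧ 0 < η₁ ∧ ∀ η ∈ Set.Ioo 0 η₁, ∃ cm cp : ℝ → ℝ,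
            (∀ ρ ∈ Set.Icc (0 : ℝ) (1 - δ), cm ρ ∈ Set.Icc (0 : ℝ) 1 ∧ cp ρ ∈ Set.Icc (0 : ℝ) 1 ∧
                cm ρ < cp ρ ∧ P k m F η ρ (cm ρ) = vlo ∧ P k m F η ρ (cp ρ) = vhi) ∧
            (∀ ρ ∈ Set.Icc (0 : ℝ) (1 - δ), HasDerivWithinAt cp
                (-(Dρ k m F η (ρ, cp ρ) / Dc k m F η (ρ, cp ρ))) (Set.Icc 0 (1 - δ)) ρ) ∧
            (∀ ρ ∈ Set.Icc (0 : ℝ) (1 - δ), HasDerivWithinAt cm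
                (-(Dρ k m F η (ρ, cm ρ) / Dc k m F η (ρ, cm ρ))) (Set.Icc 0 (1 - δ)) ρ) ∧
            (∀ s : unitInterval, (γ s).1 ≤ 1 - δ →
                |Dρ k m F η (γ s)| + |Dc k m F η (γ s)| ≤ Λ₁ / (cp (γ s).1 - cm (γ s).1) ∧
                1 ≤ Λ₁ * (cp (γ s).1 - cm (γ s).1) * (|Dρ k m F η (γ s)| + |Dc k m F η (γ s)|)) := by
  intro k hk γ hγ m F hm δ hδ hδ' vlo vhi hvlo hvv hvhi
  obtain ⟨Λ₁, η₁, hΛ₁, hη₁, hK⟩ :=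
    kestenWindowAlongPath hW hR k hk γ hγ m F hm δ hδ hδ' vlo vhi hvlo hvv hvhi
  refine ⟨Λ₁, η₁, hΛ₁, hη₁, fun η hη => ?_⟩
  have hη0 : η ≠ 0 := hη.1.ne'
  obtain ⟨hBV, hPOS, hDICT⟩ := hK η hη
  obtain ⟨Φ, hΦ, hPΦ⟩ := exists_contDiff_eq_P k m F hη0
  have hΦd : Differentiable ℝ Φ := hΦ.differentiable (by norm_num)
  -- `Dρ`, `Dc` are the partials of `Φ` on the square
  have hDρ : ∀ ρ ∈ Set.Icc (0 : ℝ) 1, ∀ c ∈ Set.Icc (0 : ℝ) 1,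
      Dρ k m F η (ρ, c) = fderiv ℝ Φ (ρ, c) (1, 0) := fun ρ hρ c hc =>
    derivWithin_eq_fderiv_fst (hΦd (ρ, c)) hρ (fun ρ' hρ' => hPΦ ρ' hρ' c hc)
  have hDc : ∀ ρ ∈ Set.Icc (0 : ℝ) 1, ∀ c ∈ Set.Icc (0 : ℝ) 1,
      Dc k m F η (ρ, c) = fderiv ℝ Φ (ρ, c) (0, 1) := fun ρ hρ c hc =>
    derivWithin_eq_fderiv_snd (hΦd (ρ, c)) hc (fun c' hc' => hPΦ ρ hρ c' hc')
  have hI : ∀ ρ ∈ Set.Icc (0 : ℝ) (1 - δ), ρ ∈ Set.Icc (0 : ℝ) 1 := fun ρ hρ => ⟨hρ.1, by linarith [hρ.2]⟩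
  have h0 : (0 : ℝ) ∈ Set.Icc (0 : ℝ) 1 := ⟨le_rfl, zero_le_one⟩
  have h1 : (1 : ℝ) ∈ Set.Icc (0 : ℝ) 1 := ⟨zero_le_one, le_rfl⟩
  -- hypotheses of the implicit function theorem for `Φ` at the two levels
  have hmonoΦ : ∀ ρ ∈ Set.Icc (0 : ℝ) (1 - δ), MonotoneOn (fun c => Φ (ρ, c)) (Set.Icc 0 1) := by
    intro ρ hρ c hc c' hc' hcc'
    show Φ (ρ, c) ≤ Φ (ρ, c')
    rw [← hPΦ ρ (hI ρ hρ) c hc, ← hPΦ ρ (hI ρ hρ) c' hc']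
    exact P_mono_c k m F hη0 ρ hcc'
  have hbv : ∀ v : ℝ, vlo ≤ v → v ≤ vhi →
      ∀ ρ ∈ Set.Icc (0 : ℝ) (1 - δ), Φ (ρ, 0) < v ∧ v < Φ (ρ, 1) := by
    intro v hv1 hv2 ρ hρ
    rw [← hPΦ ρ (hI ρ hρ) 0 h0, ← hPΦ ρ (hI ρ hρ) 1 h1]
    exact ⟨lt_of_lt_of_le (hBV ρ hρ).1 hv1, lt_of_le_of_lt hv2 (hBV ρ hρ).2⟩
  have hposΦ : ∀ v : ℝ, vlo ≤ v → v ≤ vhi → ∀ ρ ∈ Set.Icc (0 : ℝ) (1 - δ),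
      ∀ c ∈ Set.Icc (0 : ℝ) 1, Φ (ρ, c) = v → 0 < fderiv ℝ Φ (ρ, c) (0, 1) := by
    intro v hv1 hv2 ρ hρ c hc hcv
    rw [← hDc ρ (hI ρ hρ) c hc]
    refine hPOS ρ hρ c hc ?_
    rw [hPΦ ρ (hI ρ hρ) c hc, hcv]
    exact ⟨hv1, hv2⟩
  obtain ⟨cm, hcm, hcm'⟩ := stub_levelCurve_IFT Φ hΦ 0 (1 - δ) vlo (hbv vlo le_rfl hvv.le) hmonoΦ
    (hposΦ vlo le_rfl hvv.le)
  obtain ⟨cp, hcp, hcp'⟩ := stub_levelCurve_IFT Φ hΦ 0 (1 - δ) vhi (hbv vhi hvv.le le_rfl) hmonoΦ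
    (hposΦ vhi hvv.le le_rfl)
  have hcm01 : ∀ ρ ∈ Set.Icc (0 : ℝ) (1 - δ), cm ρ ∈ Set.Icc (0 : ℝ) 1 := fun ρ hρ =>
    ⟨(hcm ρ hρ).1.1.le, (hcm ρ hρ).1.2.le⟩
  have hcp01 : ∀ ρ ∈ Set.Icc (0 : ℝ) (1 - δ), cp ρ ∈ Set.Icc (0 : ℝ) 1 := fun ρ hρ =>
    ⟨(hcp ρ hρ).1.1.le, (hcp ρ hρ).1.2.le⟩
  have hPm : ∀ ρ ∈ Set.Icc (0 : ℝ) (1 - δ), P k m F η ρ (cm ρ) = vlo := fun ρ hρ => by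
    rw [hPΦ ρ (hI ρ hρ) _ (hcm01 ρ hρ)]; exact (hcm ρ hρ).2.1
  have hPp : ∀ ρ ∈ Set.Icc (0 : ℝ) (1 - δ), P k m F η ρ (cp ρ) = vhi := fun ρ hρ => by
    rw [hPΦ ρ (hI ρ hρ) _ (hcp01 ρ hρ)]; exact (hcp ρ hρ).2.1
  refine ⟨cm, cp, fun ρ hρ => ⟨hcm01 ρ hρ, hcp01 ρ hρ, ?_, hPm ρ hρ, hPp ρ hρ⟩, fun ρ hρ => ?_,
    fun ρ hρ => ?_, fun s hs => hDICT cm cp (fun ρ hρ => ⟨hcm01 ρ hρ, hcp01 ρ hρ, hPm ρ hρ, hPp ρ hρ⟩) s hs⟩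
  · -- `cm < cp` from `vlo < vhi` and monotonicity
    by_contra hle
    rw [not_lt] at hle
    have := P_mono_c k m F hη0 ρ hle
    rw [hPm ρ hρ, hPp ρ hρ] at this
    linarith
  · refine (hcp' ρ hρ).congr_deriv ?_
    rw [hDρ ρ (hI ρ hρ) _ (hcp01 ρ hρ), hDc ρ (hI ρ hρ) _ (hcp01 ρ hρ)]
  · refine (hcm' ρ hρ).congr_deriv ?_
    rw [hDρ ρ (hI ρ hρ) _ (hcm01 ρ hρ), hDc ρ (hI ρ hρ) _ (hcm01 ρ hρ)]

include hBET hW hR in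
/-- **Bulk chart data (proved composition of the two stubs above, levels `⅓ < ⅔`).**  For an RSW
path, a nonempty quad family and `δ ∈ (0,½]`: mesh-uniform constants `Θ ≥ 0`, `Λ₁ > 0` such that
for every small mesh there are a slope field `(Pρ', Pc')` (the route's `Dρ`, `Dc`) and two level
curves `cm < cp` over `[0, 1−δ]` solving `c' = −Pρ'/Pc'`, with the slope `Θ`-Lipschitz in `c`
between the curves (by monotonicity of `P` in `c` the band between the curves is the band between
the levels), and the window dictionary `G ≍ 1/(cp − cm)` at the bulk path points.  This is exactly
the input of the Grönwall engine `stub_levelGapTransport`. -/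
theorem levelCurveData :
    ∀ k : ℕ, k = 2 ∨ k = 3 → ∀ γ : unitInterval → ℝ × ℝ, PathOK k γ →
      ∀ (m : ℕ) (F : Fin m → Quad (Set.univ : Set ℂ)), 0 < m → ∀ δ : ℝ, 0 < δ → δ ≤ 1 / 2 →
        ∃ Θ Λ₁ η₁ : ℝ, 0 ≤ Θ ∧ 0 < Λ₁ ∧ 0 < η₁ ∧ ∀ η ∈ Set.Ioo 0 η₁,
          ∃ (Pρ' Pc' : ℝ × ℝ → ℝ) (cm cp : ℝ → ℝ),
            (∀ ρ ∈ Set.Icc 0 (1 - δ), cm ρ < cp ρ) ∧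
            (∀ ρ ∈ Set.Icc 0 (1 - δ),
              HasDerivWithinAt cp (-(Pρ' (ρ, cp ρ) / Pc' (ρ, cp ρ))) (Set.Icc 0 (1 - δ)) ρ) ∧
            (∀ ρ ∈ Set.Icc 0 (1 - δ),
              HasDerivWithinAt cm (-(Pρ' (ρ, cm ρ) / Pc' (ρ, cm ρ))) (Set.Icc 0 (1 - δ)) ρ) ∧
            (∀ ρ ∈ Set.Icc 0 (1 - δ), ∀ c c' : ℝ, cm ρ ≤ c → c ≤ cp ρ → cm ρ ≤ c' → c' ≤ cp ρ →
              |Pρ' (ρ, c) / Pc' (ρ, c) - Pρ' (ρ, c') / Pc' (ρ, c')| ≤ Θ * |c - c'|) ∧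
            (∀ s : unitInterval, (γ s).1 ≤ 1 - δ →
              |Dρ k m F η (γ s)| + |Dc k m F η (γ s)| ≤ Λ₁ / (cp (γ s).1 - cm (γ s).1) ∧
              1 ≤ Λ₁ * (cp (γ s).1 - cm (γ s).1) * (|Dρ k m F η (γ s)| + |Dc k m F η (γ s)|)) := by
  intro k hk γ hγ m F hm δ hδ hδ'
  obtain ⟨Θ, η₁, hΘ, hη₁, hslope⟩ := hBET k hk γ hγ m F hm δ hδ hδ'
    (1 / 3) (2 / 3) (by norm_num) (by norm_num) (by norm_num)
  obtain ⟨Λ₁, η₂, hΛ₁, hη₂, hcurves⟩ := levelCurvesAlongPath hW hR k hk γ hγ m F hm δ hδ hδ'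
    (1 / 3) (2 / 3) (by norm_num) (by norm_num) (by norm_num)
  refine ⟨Θ, Λ₁, min η₁ η₂, hΘ, hΛ₁, lt_min hη₁ hη₂, fun η hη => ?_⟩
  have hη1 : η ∈ Set.Ioo 0 η₁ := ⟨hη.1, lt_of_lt_of_le hη.2 (min_le_left _ _)⟩
  have hη2 : η ∈ Set.Ioo 0 η₂ := ⟨hη.1, lt_of_lt_of_le hη.2 (min_le_right _ _)⟩
  have hη0 : η ≠ 0 := hη.1.ne'
  obtain ⟨cm, cp, hval, hcp, hcm, hdict⟩ := hcurves η hη2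
  refine ⟨fun q => Dρ k m F η q, fun q => Dc k m F η q, cm, cp, fun ρ hρ => (hval ρ hρ).2.2.1,
    hcp, hcm, fun ρ hρ c c' h1 h2 h3 h4 => ?_, hdict⟩
  obtain ⟨hcm01, hcp01, -, hPm, hPp⟩ := hval ρ hρ
  have hc : c ∈ Set.Icc (0 : ℝ) 1 := ⟨hcm01.1.trans h1, h2.trans hcp01.2⟩
  have hc' : c' ∈ Set.Icc (0 : ℝ) 1 := ⟨hcm01.1.trans h3, h4.trans hcp01.2⟩
  have hband : ∀ x : ℝ, cm ρ ≤ x → x ≤ cp ρ → P k m F η ρ x ∈ Set.Icc (1 / 3 : ℝ) (2 / 3) := by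
    intro x hx1 hx2
    refine ⟨?_, ?_⟩
    · rw [← hPm]; exact P_mono_c k m F hη0 ρ hx1
    · rw [← hPp]; exact P_mono_c k m F hη0 ρ hx2
  exact hslope η hη1 ρ hρ c hc c' hc' (hband c h1 h2) (hband c' h3 h4)

/-! ## The bulk chart -/

include hBET hW hR in
/-- Bulk chart: level-curve data ⨉ Grönwall transport ⟹ comparability on `{s | ρ_s ≤ 1 − δ}`. -/
theorem bulkComparability {k : ℕ} (hk : k = 2 ∨ k = 3) {γ : unitInterval → ℝ × ℝ} (hγ : PathOK k γ)
    {m : ℕ} (F : Fin m → Quad (Set.univ : Set ℂ)) (hm : 0 < m) {δ : ℝ} (hδ : 0 < δ) (hδ' : δ ≤ 1 / 2) :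
    ∃ Λ₁ η₁ : ℝ, 0 < η₁ ∧ ∀ s s' : unitInterval, (γ s).1 ≤ 1 - δ → (γ s').1 ≤ 1 - δ →
      ∀ η ∈ Set.Ioo 0 η₁,
        |Dρ k m F η (γ s)| + |Dc k m F η (γ s)| ≤ Λ₁ * (|Dρ k m F η (γ s')| + |Dc k m F η (γ s')|) := by
  obtain ⟨Θ, Λ₁, η₁, hΘ, hΛ₁, hη₁, hdata⟩ := levelCurveData hBET hW hR k hk γ hγ m F hm δ hδ hδ'
  refine ⟨Λ₁ * Λ₁ * Real.exp Θ, η₁, hη₁, fun s s' hs hs' η hη => ?_⟩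
  obtain ⟨Pρ', Pc', cm, cp, hlt, hcp, hcm, hlip, hdict⟩ := hdata η hη
  have hρs : (γ s).1 ∈ Set.Icc (0 : ℝ) (1 - δ) := ⟨(hγ.2.2.2.1 s).1.1, hs⟩
  have hρs' : (γ s').1 ∈ Set.Icc (0 : ℝ) (1 - δ) := ⟨(hγ.2.2.2.1 s').1.1, hs'⟩
  have hgap := stub_levelGapTransport Pρ' Pc' cm cp 0 (1 - δ) Θ (by linarith) hΘ hlt hcp hcm hlip
    (γ s').1 hρs' (γ s).1 hρs
  -- `D(ρ_{s'}) ≤ e^{Θ|ρ_{s'}−ρ_s|} D(ρ_s) ≤ e^{Θ} D(ρ_s)`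
  set Ds := cp (γ s).1 - cm (γ s).1 with hDs
  set Ds' := cp (γ s').1 - cm (γ s').1 with hDs'
  have hDs_pos : 0 < Ds := sub_pos.2 (hlt _ hρs)
  have hDs'_pos : 0 < Ds' := sub_pos.2 (hlt _ hρs')
  have habs : |(γ s').1 - (γ s).1| ≤ 1 := by
    rw [abs_le]
    constructor <;> nlinarith [hρs.1, hρs.2, hρs'.1, hρs'.2, (hγ.2.2.2.1 s).1.2, (hγ.2.2.2.1 s').1.2]
  have hexp : Real.exp (Θ * |(γ s').1 - (γ s).1|) ≤ Real.exp Θ := by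
    apply Real.exp_le_exp.2
    nlinarith [abs_nonneg ((γ s').1 - (γ s).1)]
  have hgap' : Ds' ≤ Real.exp Θ * Ds := by
    calc Ds' ≤ Real.exp (Θ * |(γ s').1 - (γ s).1|) * Ds := hgap
      _ ≤ Real.exp Θ * Ds := by gcongr
  obtain ⟨hGs, -⟩ := hdict s hs
  obtain ⟨-, hGs'⟩ := hdict s' hs'
  set Gs := |Dρ k m F η (γ s)| + |Dc k m F η (γ s)| with hGs_def
  set Gs' := |Dρ k m F η (γ s')| + |Dc k m F η (γ s')| with hGs'_def
  have hGs'_nn : 0 ≤ Gs' := by positivity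
  -- `1/D(ρ_{s'}) ≤ Λ₁ G(s')`
  have h1 : 1 / Ds' ≤ Λ₁ * Gs' := by
    rw [div_le_iff₀ hDs'_pos]
    nlinarith
  -- assemble
  have h2 : Gs ≤ Λ₁ / Ds := hGs
  have h3 : Λ₁ / Ds ≤ Λ₁ * Real.exp Θ / Ds' := by
    rw [div_le_div_iff₀ hDs_pos hDs'_pos]
    nlinarith [Real.exp_pos Θ]
  have h4 : Λ₁ * Real.exp Θ / Ds' = Λ₁ * Real.exp Θ * (1 / Ds') := by ring
  calc Gs ≤ Λ₁ / Ds := h2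
    _ ≤ Λ₁ * Real.exp Θ / Ds' := h3
    _ = Λ₁ * Real.exp Θ * (1 / Ds') := h4
    _ ≤ Λ₁ * Real.exp Θ * (Λ₁ * Gs') := by
        have : 0 ≤ Λ₁ * Real.exp Θ := by positivity
        exact mul_le_mul_of_nonneg_left h1 this
    _ = Λ₁ * Λ₁ * Real.exp Θ * Gs' := by ring

end Summit.CriticalPhenomena.CardyFormulaZ2.Theorems.CardySelfRefinement

end
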